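import Summits.QuantumAdvantage.AdviceFreeQNC0.LogDegreeResidueBalance
import HarnessLib

/-!
# Cell qa-qnc0 (rung F-Q1, route RingFrame, crux α, line `product`): residue balance mod 3 for
# SPARSE low-degree supports beyond degree `½ log₂ n` (Kaufman–Lovett–Porat derivatives + Viola–Wigderson)

A new rung-type theorem for the planner's PLDAMS ladder (HOME/qa-qnc0-p1/TARGET.md §18, Sketch5.lean),
attacking the open rungs from the SPARSE end.  Rung 0 (`pldamsLogRung`, `card_support_le_four_mul_card_class`)
covers every support at degree `d ≲ ½log₂ n`; here the degree may exceed `½log₂ n` by the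
log-sparsity of the support:

* `sparse_card_support_le_four_mul_card_class`: if `g ∈ lowDeg 𝔽₂ n d`, `2^{k+1}·#{g ≠ 0} ≤ 2ⁿ`
  (density `≤ 2^{−k−1}`) and `4(d+4)·4^{d−k} ≤ n`, then every residue class `|u| ≡ r (mod 3)` carries
  at least a quarter of the support.  E.g. at degree `d = C·log₂ n` (rung 1) all supports of density
  `≤ n^{−(C−½)}/polylog` are covered.

Mechanism (Kaufman–Lovett–Porat, *Weight distribution and list-decoding size of Reed–Muller codes*,
IEEE IT 2012 / arXiv:0811.2356, §2.1: Claim 12 "if a function has non-zero bias, it can be computed by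
an average of its derivatives: `(−1)^{g(x)} = bias(g)^{−1}·E_a (−1)^{g_a(x)}`", Claim 13 "derivatives of a
low-weight function have low weight", Lemma 10 "Main technical lemma"): a function of density
`≤ 2^{−k−1}` is, `k` times over, an average of its discrete derivatives with total weight
`Π_{r≤k} (1 − 2^{−r})^{−1} ≤ e²`; so for ANY test function `χ`,
`|Σ_x (−1)^{g(x)} χ(x)| ≤ e²·max_{a₁…a_k} |Σ_x (−1)^{g_{a₁…a_k}(x)} χ(x)|`
(`norm_sum_signChar_le_of_sparse`, stated with the level-dependent constant `exp(2 − 2^{1−k})`).  The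
`k`-fold derivatives of a degree-`d` polynomial have degree `≤ d − k` (tree lemma
`GowersCube.derivXor_mem_lowDeg`), so the Viola–Wigderson bound at `ζ = ω`
(`norm_sum_signChar_mul_omega3_pow_le`) improves from `e^{−3n/(8·4^d)}` to `e²·e^{−3n/(8·4^{d−k})}`,
and the class-count/Schwartz–Zippel absorption of `LogDegreeResidueBalance.lean` finishes.

The combination is the cell's (not in print); the two inputs are.  WHAT THIS IS NOT: nothing for
supports denser than `2^{−(d − ½log₂ n)}`; rung 1 (`PLDAMSCLog C`) stays open for dense supports;
nothing on `LDMAPolylog` or α.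

## References

* T. Kaufman, S. Lovett, E. Porat, *Weight distribution and list-decoding size of Reed–Muller
  codes*, IEEE Trans. Inform. Theory 58 (2012) / arXiv:0811.2356, §2.1, Claims 12–13, Lemma 10
  [KaufmanLovettPorat2012].
* E. Viola, A. Wigderson, *Norms, XOR lemmas, and lower bounds for polynomials and protocols*,
  Theory of Computing 4 (2008), Thm. 2.9 [ViolaWigderson2008].
-/

noncomputable section

namespace Summit.QuantumAdvantage.AdviceFreeQNC0

open Finset
open Literature.Computability.MetaComplexity Literature.Computability.MetaComplexity.Smolensky
open Literature.Computability.MetaComplexity.Hegedus Literature.Computability.MetaComplexity.GowersCube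

variable {n : ℕ}

/-! ### Discrete derivatives and their iterates -/

/-- The discrete derivative `Δ_a g (x) = g(x) + g(x ⊕ a)`. [cite: KaufmanLovettPorat2012, Definition 5] -/
def deriv (a : Fin n → Bool) (g : CubeFn (ZMod 2) n) : CubeFn (ZMod 2) n :=
  fun x => g x + g (xorShift x a)

/-- Iterated derivative `Δ_{a_k} ⋯ Δ_{a_1} g` along a list of directions. [cite: KaufmanLovettPorat2012, Definition 5] -/
def iterDeriv (g : CubeFn (ZMod 2) n) : List (Fin n → Bool) → CubeFn (ZMod 2) n
  | [] => g
  | a :: l => iterDeriv (deriv a g) l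

/-- A derivative lowers the degree by one (degree `0` stays `0`). [cite: ViolaWigderson2008, §2.1] -/
theorem deriv_mem_lowDeg {d : ℕ} {g : CubeFn (ZMod 2) n} (hg : g ∈ lowDeg (ZMod 2) n d) (a : Fin n → Bool) :
    deriv a g ∈ lowDeg (ZMod 2) n (d - 1) := by
  have hg' : g ∈ lowDeg (ZMod 2) n (d - 1 + 1) := lowDeg_mono (by omega) hg
  exact derivXor_mem_lowDeg hg' a

/-- `k` derivatives lower the degree by `k`. [cite: ViolaWigderson2008, §2.1] -/
theorem iterDeriv_mem_lowDeg {d : ℕ} {g : CubeFn (ZMod 2) n} (hg : g ∈ lowDeg (ZMod 2) n d)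
    (l : List (Fin n → Bool)) : iterDeriv g l ∈ lowDeg (ZMod 2) n (d - l.length) := by
  induction l generalizing g d with
  | nil => simpa [iterDeriv] using hg
  | cons a l ih =>
    have h := ih (deriv_mem_lowDeg hg a) (d := d - 1)
    simpa [iterDeriv, List.length_cons, Nat.sub_sub, Nat.add_comm] using h

/-- A derivative at most doubles the support: `#{Δ_a g ≠ 0} ≤ 2·#{g ≠ 0}`.
[cite: KaufmanLovettPorat2012, Claim 13] -/
theorem card_support_deriv_le (a : Fin n → Bool) (g : CubeFn (ZMod 2) n) :
    (univ.filter fun x : Fin n → Bool => deriv a g x ≠ 0).card ≤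
      2 * (univ.filter fun x : Fin n → Bool => g x ≠ 0).card := by
  classical
  have hinv : ∀ x : Fin n → Bool, xorShift (xorShift x a) a = x := fun x => by
    funext i; simp [xorShift]
  -- `supp Δ_a g ⊆ supp g ∪ (supp g shifted by a)`
  have hsub : (univ.filter fun x : Fin n → Bool => deriv a g x ≠ 0) ⊆
      (univ.filter fun x : Fin n → Bool => g x ≠ 0) ∪
        (univ.filter fun x : Fin n → Bool => g x ≠ 0).image fun x => xorShift x a := by
    intro x hx
    have hx' := (Finset.mem_filter.1 hx).2
    rw [Finset.mem_union, Finset.mem_filter, Finset.mem_image]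
    by_cases h1 : g x = 0
    · right
      have h2 : g (xorShift x a) ≠ 0 := fun h2 => hx' (by rw [deriv, h1, h2, add_zero])
      exact ⟨xorShift x a, Finset.mem_filter.2 ⟨Finset.mem_univ _, h2⟩, hinv x⟩
    · left; exact ⟨Finset.mem_univ _, h1⟩
  refine (Finset.card_le_card hsub).trans ((Finset.card_union_le _ _).trans ?_)
  rw [two_mul]
  exact Nat.add_le_add_left Finset.card_image_le _

/-! ### Kaufman–Lovett–Porat: a sparse function is an average of its derivatives -/

/-- The bias `β(g) = Σ_x (−1)^{g(x)} = 2ⁿ − 2·#{g ≠ 0}` (a real number). [cite: KaufmanLovettPorat2012, Definition 6] -/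
theorem sum_signChar_eq (g : CubeFn (ZMod 2) n) :
    ∑ x : Fin n → Bool, signChar (g x) =
      ((2 : ℂ) ^ n - 2 * (univ.filter fun x : Fin n → Bool => g x ≠ 0).card) := by
  classical
  have h : ∀ x : Fin n → Bool, signChar (g x) = 1 - 2 * (if g x ≠ 0 then (1 : ℂ) else 0) := by
    intro x
    by_cases hx : g x = 0
    · simp [hx, signChar]
    · simp [hx, signChar]; norm_num
  rw [Finset.sum_congr rfl fun x _ => h x, Finset.sum_sub_distrib, Finset.sum_const, Finset.card_univ,
    Fintype.card_fun, Fintype.card_bool, Fintype.card_fin, ← Finset.mul_sum, ← Finset.sum_boole]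
  simp

/-- **KLP Claim 12 (averaging identity).** For every `g`, test function `χ` and point set:
`(Σ_y (−1)^{g(y)}) · Σ_x (−1)^{g(x)} χ(x) = Σ_a Σ_x (−1)^{Δ_a g(x)} χ(x)`.
[cite: KaufmanLovettPorat2012, Claim 12] -/
theorem sum_signChar_mul_sum_eq_sum_deriv (g : CubeFn (ZMod 2) n) (χ : (Fin n → Bool) → ℂ) :
    (∑ y : Fin n → Bool, signChar (g y)) * ∑ x : Fin n → Bool, signChar (g x) * χ x =
      ∑ a : Fin n → Bool, ∑ x : Fin n → Bool, signChar (deriv a g x) * χ x := by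
  classical
  rw [Finset.sum_comm, Finset.mul_sum]
  refine Finset.sum_congr rfl fun x _ => ?_
  -- `Σ_a (−1)^{g x + g(x ⊕ a)} χ x = (−1)^{g x} χ x · Σ_a (−1)^{g (x ⊕ a)} = (−1)^{g x} χ x · Σ_y (−1)^{g y}`
  have hre : ∑ a : Fin n → Bool, signChar (g (xorShift x a)) = ∑ y : Fin n → Bool, signChar (g y) := by
    refine Fintype.sum_equiv (Equiv.mk (fun a => xorShift x a) (fun y => xorShift x y) (fun a => ?_) (fun y => ?_)) _ _ (fun a => rfl)
    · funext i; simp [xorShift]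
    · funext i; simp [xorShift]
  simp only [deriv, signChar_add]
  rw [← hre, Finset.sum_mul]
  refine Finset.sum_congr rfl fun a _ => ?_
  ring

/-- `(1 + 2x)(1 − x) ≥ 1` on `[0, ½]`, in the form used for the level constants. [folklore] -/
private theorem level_const_step {k : ℕ} (hk : 1 ≤ k) :
    Real.exp (2 - (2 : ℝ) ^ (1 - (k : ℤ)) + (2 : ℝ) ^ (1 - (k : ℤ)) - (2 : ℝ) ^ (1 - ((k - 1 : ℕ) : ℤ))) *
        (1 - ((2 : ℝ) ^ k)⁻¹)⁻¹ ≤ Real.exp (2 - (2 : ℝ) ^ (1 - (k : ℤ))) := by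
  -- `2^{1-k} - 2^{1-(k-1)} = -2^{1-k}`, so the left exponential is `exp(2 - 2^{1-k}) · exp(-2^{1-k})`... we use
  -- `exp(x)·(1-x/2)^{-1} ≤ exp(x)·exp(x) = exp(2x)`? Simpler: with `x = 2^{-k} ≤ 1/2`,
  -- `exp(2 - 2x - ... )`: rewrite everything in terms of `x`.
  have hx : ((2 : ℝ) ^ k)⁻¹ ≤ 1 / 2 := by
    rw [one_div]
    exact inv_anti₀ (by norm_num) (by
      calc (2 : ℝ) = 2 ^ 1 := by norm_num
        _ ≤ 2 ^ k := pow_le_pow_right₀ (by norm_num) hk)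
  have hx0 : (0 : ℝ) < ((2 : ℝ) ^ k)⁻¹ := by positivity
  set x : ℝ := ((2 : ℝ) ^ k)⁻¹ with hxdef
  have h1 : (2 : ℝ) ^ (1 - (k : ℤ)) = 2 * x := by
    rw [hxdef, zpow_sub₀ (by norm_num), zpow_one, zpow_natCast, div_eq_mul_inv]
  have h2 : (2 : ℝ) ^ (1 - ((k - 1 : ℕ) : ℤ)) = 4 * x := by
    rw [hxdef, zpow_sub₀ (by norm_num), zpow_one, zpow_natCast, div_eq_mul_inv]
    have : (2 : ℝ) ^ k = 2 ^ (k - 1) * 2 := by rw [← pow_succ, Nat.sub_add_cancel hk]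
    rw [this, mul_inv]
    ring
  rw [h1, h2]
  have hexp : Real.exp (2 - 2 * x + 2 * x - 4 * x) = Real.exp (2 - 2 * x) * Real.exp (-(2 * x)) := by
    rw [← Real.exp_add]; ring_nf
  rw [hexp, mul_assoc]
  refine mul_le_of_le_one_right (Real.exp_nonneg _) ?_
  -- `exp(-2x) · (1-x)^{-1} ≤ 1` iff `1 ≤ exp(2x)(1-x)`, and `exp(2x) ≥ 1 + 2x`, `(1+2x)(1-x) ≥ 1`
  have h1x : 0 < 1 - x := by linarith
  rw [Real.exp_neg, ← mul_inv, inv_le_one_iff₀]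
  right
  have := Real.add_one_le_exp (2 * x)
  nlinarith

/-- **KLP Lemma 10, inequality form, for any test function.** If `2^{k+1}·#{g ≠ 0} ≤ 2ⁿ` and every
`k`-fold derivative `Δ_{a_k}⋯Δ_{a_1} g` satisfies `|Σ_x (−1)^{Δ…g(x)} χ(x)| ≤ M`, then
`|Σ_x (−1)^{g(x)} χ(x)| ≤ exp(2 − 2^{1−k})·M ≤ e²·M` (the product of the inverse biases
`Π_{r=1}^{k} (1 − 2^{−r})^{−1}`, KLP's `α ≤ 10/ε`). [cite: KaufmanLovettPorat2012, Lemma 10 (Main technical lemma), Claims 12–13] -/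
theorem norm_sum_signChar_le_of_sparse (χ : (Fin n → Bool) → ℂ) :
    ∀ (k : ℕ) (g : CubeFn (ZMod 2) n) (M : ℝ), 0 ≤ M →
      2 ^ (k + 1) * (univ.filter fun x : Fin n → Bool => g x ≠ 0).card ≤ 2 ^ n →
      (∀ l : List (Fin n → Bool), l.length = k → ‖∑ x : Fin n → Bool, signChar (iterDeriv g l x) * χ x‖ ≤ M) →
      ‖∑ x : Fin n → Bool, signChar (g x) * χ x‖ ≤ Real.exp (2 - (2 : ℝ) ^ (1 - (k : ℤ))) * M := by
  intro k
  induction k with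
  | zero =>
    intro g M _ _ hM
    have h := hM [] rfl
    simp only [iterDeriv] at h
    simpa using h
  | succ k ih =>
    intro g M hM0 hsparse hM
    classical
    set N := (univ.filter fun x : Fin n → Bool => g x ≠ 0).card with hN
    -- the bias is large: `β = 2ⁿ − 2N ≥ 2ⁿ(1 − 2^{−(k+1)}) > 0`
    set β : ℂ := ∑ y : Fin n → Bool, signChar (g y) with hβ
    have hβval : β = ((2 : ℝ) ^ n - 2 * N : ℝ) := by
      rw [hβ, sum_signChar_eq]; push_cast; rfl
    have hsparseR : (2 : ℝ) ^ (k + 1 + 1) * N ≤ 2 ^ n := by exact_mod_cast hsparse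
    have hβpos : (0 : ℝ) < 2 ^ n - 2 * N := by
      have hk1 : (1 : ℝ) ≤ 2 ^ k := one_le_pow₀ (by norm_num)
      have hN0 : (0 : ℝ) ≤ N := Nat.cast_nonneg N
      have : (2 : ℝ) * N ≤ 2 ^ n / 2 := by
        rw [pow_succ, pow_succ] at hsparseR
        nlinarith [mul_nonneg (sub_nonneg.2 hk1) hN0]
      nlinarith [pow_pos (show (0:ℝ) < 2 by norm_num) n]
    have hβge : (2 : ℝ) ^ n * (1 - ((2 : ℝ) ^ (k + 1))⁻¹) ≤ 2 ^ n - 2 * N := by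
      rw [mul_sub, mul_one]
      have : (2 : ℝ) * N ≤ 2 ^ n * ((2 : ℝ) ^ (k + 1))⁻¹ := by
        rw [← div_eq_mul_inv, le_div_iff₀ (by positivity)]
        calc 2 * (N : ℝ) * 2 ^ (k + 1) = 2 ^ (k + 1 + 1) * N := by ring
          _ ≤ 2 ^ n := hsparseR
      linarith
    -- each derivative is sparse at level `k` and inherits the hypothesis on `k`-fold derivatives
    have hder : ∀ a : Fin n → Bool,
        ‖∑ x : Fin n → Bool, signChar (deriv a g x) * χ x‖ ≤ Real.exp (2 - (2 : ℝ) ^ (1 - (k : ℤ))) * M := by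
      intro a
      refine ih (deriv a g) M hM0 ?_ (fun l hl => ?_)
      · calc 2 ^ (k + 1) * (univ.filter fun x : Fin n → Bool => deriv a g x ≠ 0).card
            ≤ 2 ^ (k + 1) * (2 * N) := Nat.mul_le_mul_left _ (card_support_deriv_le a g)
          _ = 2 ^ (k + 1 + 1) * N := by ring
          _ ≤ 2 ^ n := hsparse
      · have := hM (a :: l) (by simp [hl])
        simpa [iterDeriv] using this
    -- the averaging identity
    have hid := sum_signChar_mul_sum_eq_sum_deriv g χ
    have hnormid : ‖β‖ * ‖∑ x : Fin n → Bool, signChar (g x) * χ x‖ ≤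
        (2 : ℝ) ^ n * (Real.exp (2 - (2 : ℝ) ^ (1 - (k : ℤ))) * M) := by
      rw [← norm_mul, hβ, hid]
      calc ‖∑ a : Fin n → Bool, ∑ x : Fin n → Bool, signChar (deriv a g x) * χ x‖
          ≤ ∑ a : Fin n → Bool, ‖∑ x : Fin n → Bool, signChar (deriv a g x) * χ x‖ := norm_sum_le _ _
        _ ≤ ∑ _a : Fin n → Bool, Real.exp (2 - (2 : ℝ) ^ (1 - (k : ℤ))) * M := Finset.sum_le_sum fun a _ => hder a
        _ = (2 : ℝ) ^ n * (Real.exp (2 - (2 : ℝ) ^ (1 - (k : ℤ))) * M) := by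
            rw [Finset.sum_const, Finset.card_univ, Fintype.card_fun, Fintype.card_bool, Fintype.card_fin,
              nsmul_eq_mul]
            push_cast; ring
    have hβnorm : ‖β‖ = (2 : ℝ) ^ n - 2 * N := by
      rw [hβval, Complex.norm_real, Real.norm_eq_abs, abs_of_pos hβpos]
    rw [hβnorm] at hnormid
    -- divide: `‖Σ‖ ≤ 2ⁿ e^{…} M / (2ⁿ − 2N) ≤ e^{…} M / (1 − 2^{−(k+1)})`
    have hS : ‖∑ x : Fin n → Bool, signChar (g x) * χ x‖ ≤
        Real.exp (2 - (2 : ℝ) ^ (1 - (k : ℤ))) * M * (1 - ((2 : ℝ) ^ (k + 1))⁻¹)⁻¹ := by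
      have hq : 0 < (1 - ((2 : ℝ) ^ (k + 1))⁻¹) := by
        have : ((2 : ℝ) ^ (k + 1))⁻¹ ≤ 1 / 2 := by
          rw [one_div]; exact inv_anti₀ (by norm_num) (by
            calc (2:ℝ) = 2 ^ 1 := by norm_num
              _ ≤ 2 ^ (k + 1) := pow_le_pow_right₀ (by norm_num) (by omega))
        linarith
      rw [le_mul_inv_iff₀ hq]
      have h2n : (0 : ℝ) < 2 ^ n := by positivity
      nlinarith [norm_nonneg (∑ x : Fin n → Bool, signChar (g x) * χ x), Real.exp_nonneg (2 - (2 : ℝ) ^ (1 - (k : ℤ)))]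
    -- the level constants: `exp(2 − 2^{1−k}) (1 − 2^{−(k+1)})^{−1} ≤ exp(2 − 2^{1−(k+1)})`
    have hstep := level_const_step (k := k + 1) (by omega)
    simp only [Nat.add_sub_cancel] at hstep
    have hrew : Real.exp (2 - (2 : ℝ) ^ (1 - ((k + 1 : ℕ) : ℤ)) + (2 : ℝ) ^ (1 - ((k + 1 : ℕ) : ℤ)) -
        (2 : ℝ) ^ (1 - (k : ℤ))) = Real.exp (2 - (2 : ℝ) ^ (1 - (k : ℤ))) := by
      congr 1; ring
    rw [hrew] at hstep
    calc ‖∑ x : Fin n → Bool, signChar (g x) * χ x‖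
        ≤ Real.exp (2 - (2 : ℝ) ^ (1 - (k : ℤ))) * M * (1 - ((2 : ℝ) ^ (k + 1))⁻¹)⁻¹ := hS
      _ = Real.exp (2 - (2 : ℝ) ^ (1 - (k : ℤ))) * (1 - ((2 : ℝ) ^ (k + 1))⁻¹)⁻¹ * M := by ring
      _ ≤ Real.exp (2 - (2 : ℝ) ^ (1 - ((k + 1 : ℕ) : ℤ))) * M := mul_le_mul_of_nonneg_right hstep hM0

/-! ### Sparse supports are balanced mod 3 beyond degree `½ log₂ n` -/

/-- `e² ≤ 8`. [folklore] -/
private theorem exp_two_le_eight : Real.exp 2 ≤ 8 := by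
  have h := Real.exp_one_lt_d9
  have : Real.exp 2 = Real.exp 1 * Real.exp 1 := by rw [← Real.exp_add]; norm_num
  rw [this]; nlinarith [Real.exp_pos (1 : ℝ)]

/-- The character sum of a sparse low-degree support: for `g ∈ lowDeg 𝔽₂ n d` with
`2^{k+1}·#{g ≠ 0} ≤ 2ⁿ`, `‖Σ_{u : g u ≠ 0} ω^{|u|}‖ ≤ (1 + 8·2ⁿ·e^{−3n/(8·4^{d−k})})/2`.
[cite: KaufmanLovettPorat2012, Lemma 10; ViolaWigderson2008, Theorem 2.9] -/
theorem norm_supportCharSum_le_of_sparse {d k : ℕ} (g : CubeFn (ZMod 2) n) (hg : g ∈ lowDeg (ZMod 2) n d)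
    (hsparse : 2 ^ (k + 1) * (univ.filter fun x : Fin n → Bool => g x ≠ 0).card ≤ 2 ^ n) :
    ‖∑ u ∈ univ.filter (fun u : Fin n → Bool => g u ≠ 0), omega3 ^ wt u‖ ≤
      (1 + 8 * (2 : ℝ) ^ n * Real.exp (-(3 * (n : ℝ) / (8 * 4 ^ (d - k))))) / 2 := by
  set S := ∑ u ∈ univ.filter (fun u : Fin n → Bool => g u ≠ 0), omega3 ^ wt u with hS
  set T := ∑ u : Fin n → Bool, omega3 ^ wt u with hT
  set V := ∑ u : Fin n → Bool, signChar (g u) * omega3 ^ wt u with hV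
  have hid : V = T - 2 * S := by
    have hS' : S = ∑ u : Fin n → Bool, if g u ≠ 0 then omega3 ^ wt u else 0 := by
      rw [hS, Finset.sum_filter]
    rw [hS', hT, hV, Finset.mul_sum, ← Finset.sum_sub_distrib]
    refine Finset.sum_congr rfl fun u _ => ?_
    by_cases hu : g u = 0
    · simp [hu, signChar]
    · simp [hu, signChar]
      ring
  -- KLP + VW on the `k`-fold derivatives (degree `≤ d − k`)
  set M : ℝ := (2 : ℝ) ^ n * Real.exp (-(3 * (n : ℝ) / (8 * 4 ^ (d - k)))) with hM
  have hM0 : 0 ≤ M := by positivity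
  have hV' : ‖V‖ ≤ Real.exp (2 - (2 : ℝ) ^ (1 - (k : ℤ))) * M := by
    refine norm_sum_signChar_le_of_sparse (fun u => omega3 ^ wt u) k g M hM0 hsparse fun l hl => ?_
    have hdeg := iterDeriv_mem_lowDeg hg l
    rw [hl] at hdeg
    exact norm_sum_signChar_mul_omega3_pow_le hdeg
  have hV8 : ‖V‖ ≤ 8 * M := by
    refine hV'.trans (mul_le_mul_of_nonneg_right ?_ hM0)
    calc Real.exp (2 - (2 : ℝ) ^ (1 - (k : ℤ))) ≤ Real.exp 2 :=
          Real.exp_le_exp.2 (by linarith [zpow_pos (show (0:ℝ) < 2 by norm_num) (1 - (k : ℤ))])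
      _ ≤ 8 := exp_two_le_eight
  have h2S : 2 * S = T - V := by rw [hid]; ring
  have hnorm : 2 * ‖S‖ ≤ 1 + 8 * M := by
    calc 2 * ‖S‖ = ‖2 * S‖ := by rw [norm_mul, Complex.norm_ofNat]
      _ = ‖T - V‖ := by rw [h2S]
      _ ≤ ‖T‖ + ‖V‖ := norm_sub_le _ _
      _ ≤ 1 + 8 * M := by rw [hT, norm_sum_omega3_pow_wt]; linarith
  rw [hM] at hnorm
  linarith

/-- The sparse error term is absorbed by the Reed–Muller bound: if `4(d+4)·4^{d−k} ≤ n` then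
`4·(1 + 8·2ⁿ e^{−3n/(8·4^{d−k})}) ≤ 2^{n−d}`. [folklore] -/
theorem four_mul_one_add_sparse_err_le_two_pow {n d k : ℕ} (hn : 4 * (d + 4) * 4 ^ (d - k) ≤ n) :
    4 * (1 + 8 * (2 : ℝ) ^ n * Real.exp (-(3 * (n : ℝ) / (8 * 4 ^ (d - k))))) ≤ (2 : ℝ) ^ (n - d) := by
  have h4d : (1 : ℝ) ≤ 4 ^ (d - k) := one_le_pow₀ (by norm_num)
  have hdn : d + 4 ≤ n := by
    have : 4 * (d + 4) ≤ 4 * (d + 4) * 4 ^ (d - k) := Nat.le_mul_of_pos_right _ (by positivity)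
    omega
  have hn' : (4 : ℝ) * (d + 4) * 4 ^ (d - k) ≤ n := by exact_mod_cast hn
  -- (i) exponent ≥ `3(d+4)/2`
  have hexp : Real.exp (-(3 * (n : ℝ) / (8 * 4 ^ (d - k)))) ≤ Real.exp (-(3 / 2)) ^ (d + 4) := by
    rw [← Real.exp_nat_mul, Real.exp_le_exp]
    have : (3 : ℝ) / 2 * (d + 4) ≤ 3 * (n : ℝ) / (8 * 4 ^ (d - k)) := by
      rw [le_div_iff₀ (by positivity)]
      nlinarith
    push_cast
    linarith
  -- (ii) `e^{-3/2} ≤ 1/4`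
  have hq : Real.exp (-(3 / 2 : ℝ)) ≤ 1 / 4 := by
    have h1 : (2.7182818283 : ℝ) < Real.exp 1 := Real.exp_one_gt_d9
    have h2 : (1 / 2 : ℝ) + 1 ≤ Real.exp (1 / 2) := Real.add_one_le_exp _
    have h3 : Real.exp (3 / 2) = Real.exp 1 * Real.exp (1 / 2) := by rw [← Real.exp_add]; norm_num
    have h4 : (4 : ℝ) ≤ Real.exp (3 / 2) := by rw [h3]; nlinarith [Real.exp_pos 1, Real.exp_pos (1/2 : ℝ)]
    rw [Real.exp_neg, one_div]
    exact inv_anti₀ (by norm_num) h4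
  have hq' : Real.exp (-(3 / 2 : ℝ)) ^ (d + 4) ≤ (1 / 4 : ℝ) ^ (d + 4) :=
    pow_le_pow_left₀ (Real.exp_nonneg _) hq _
  -- (iii) `8 · 2ⁿ (1/4)^{d+4} = 2^{n-d} · 2^d · 8 / 4^{d+4} ≤ 2^{n-d}/32`
  have hsplit : (2 : ℝ) ^ n = 2 ^ (n - d) * 2 ^ d := by
    rw [← pow_add, Nat.sub_add_cancel (by omega)]
  have h24 : (2 : ℝ) ^ d ≤ 4 ^ d := pow_le_pow_left₀ (by norm_num) (by norm_num) d
  have hiii : 8 * (2 : ℝ) ^ n * (1 / 4 : ℝ) ^ (d + 4) ≤ 2 ^ (n - d) / 32 := by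
    have hkey : (2 : ℝ) ^ d * (4 ^ d)⁻¹ ≤ 1 := by
      rw [mul_inv_le_iff₀ (by positivity), one_mul]; exact h24
    have h4ne : (4 : ℝ) ^ d ≠ 0 := by positivity
    calc 8 * (2 : ℝ) ^ n * (1 / 4 : ℝ) ^ (d + 4)
        = 2 ^ (n - d) / 32 * (2 ^ d * (4 ^ d)⁻¹) := by
          rw [hsplit, one_div_pow, pow_add]; field_simp; ring
      _ ≤ 2 ^ (n - d) / 32 * 1 := mul_le_mul_of_nonneg_left hkey (by positivity)
      _ = 2 ^ (n - d) / 32 := mul_one _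
  -- (iv) `2^{n-d} ≥ 16`
  have h16 : (16 : ℝ) ≤ 2 ^ (n - d) := by
    have : (2 : ℝ) ^ 4 ≤ 2 ^ (n - d) := pow_le_pow_right₀ (by norm_num) (by omega)
    norm_num at this; exact this
  have herr : 8 * (2 : ℝ) ^ n * Real.exp (-(3 * (n : ℝ) / (8 * 4 ^ (d - k)))) ≤ 2 ^ (n - d) / 32 :=
    calc 8 * (2 : ℝ) ^ n * Real.exp (-(3 * (n : ℝ) / (8 * 4 ^ (d - k))))
        ≤ 8 * 2 ^ n * Real.exp (-(3 / 2)) ^ (d + 4) := mul_le_mul_of_nonneg_left hexp (by positivity)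
      _ ≤ 8 * 2 ^ n * (1 / 4 : ℝ) ^ (d + 4) := mul_le_mul_of_nonneg_left hq' (by positivity)
      _ ≤ 2 ^ (n - d) / 32 := hiii
  linarith

/-- **Sparse supports are balanced mod 3 beyond rung 0.** If `g ∈ lowDeg 𝔽₂ n d` has density
`≤ 2^{−k−1}` (`2^{k+1}·#{g ≠ 0} ≤ 2ⁿ`) and `4(d+4)·4^{d−k} ≤ n`, then for every `r`,
`#{u : g u ≠ 0} ≤ 4·#{u : g u ≠ 0, |u| ≡ r (mod 3)}`.  (KLP derivatives + Viola–Wigderson +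
Schwartz–Zippel; the cell's combination.) [cite: KaufmanLovettPorat2012, Lemma 10; ViolaWigderson2008, Theorem 2.9] -/
theorem sparse_card_support_le_four_mul_card_class {n d k : ℕ} (hn : 4 * (d + 4) * 4 ^ (d - k) ≤ n)
    (g : CubeFn (ZMod 2) n) (hg : g ∈ lowDeg (ZMod 2) n d)
    (hsparse : 2 ^ (k + 1) * (univ.filter fun x : Fin n → Bool => g x ≠ 0).card ≤ 2 ^ n) (r : ℕ) :
    (univ.filter fun u : Fin n → Bool => g u ≠ 0).card ≤
      4 * (univ.filter fun u : Fin n → Bool => g u ≠ 0 ∧ wt u % 3 = r % 3).card := by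
  classical
  by_cases hg0 : g = 0
  · subst hg0; simp
  have hB : (2 : ℝ) ^ (n - d) ≤ (univ.filter fun u : Fin n → Bool => g u ≠ 0).card := by
    exact_mod_cast two_pow_le_card_support hg hg0
  have hcls := abs_three_mul_card_filter_mod_sub_card_le (univ.filter fun u : Fin n → Bool => g u ≠ 0) r
  rw [Finset.filter_filter] at hcls
  have hchar := norm_supportCharSum_le_of_sparse g hg hsparse
  have herr := four_mul_one_add_sparse_err_le_two_pow hn
  have h := (abs_le.1 hcls).1
  have hreal : ((univ.filter fun u : Fin n → Bool => g u ≠ 0).card : ℝ) ≤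
      4 * (univ.filter fun u : Fin n → Bool => g u ≠ 0 ∧ wt u % 3 = r % 3).card := by
    linarith
  exact_mod_cast hreal

end Summit.QuantumAdvantage.AdviceFreeQNC0
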